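import Literature.MathematicalPhysics.QuantumFieldTheory.Balaban1983to89.B6MinimalOrbitV1
import Literature.MathematicalPhysics.QuantumFieldTheory.Balaban1983to89.B6Eq28MultiLevelV1

/-!
# `Balaban1983to89.B6SectADeltaACoerciveReductionV1` — T. Bałaban, *Propagators and renormalization transformations for lattice gauge
# theories. II*, Commun. Math. Phys. **96** (1984) 223–250 [Balaban1984PropagatorsII], p. 226 «the operator Δ_a is bounded from below by a
# positive constant» ON THE V1 MULTI-LEVEL TORUS CALCULUS, QUANTITATIVELY: **an EXPLICIT coercivity constant for `Δ_a = ∂*∂ + ∂R∂* + Q*aQ`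
# (2.19) from THREE LETTERS — a Lemma-2.4-shaped bound on the axially gauged configurations, a (2.11)-shaped Poincaré bound on `N(Q′)`, and the
# axial-gauge decomposition `A = B + ∂λ`** (the reduction step; the letters are Lemma 2.4 (2.128) p. 245, (2.11) p. 225 and (2.121) p. 244)

statement-level skeleton of published theorems with citation tags; proofs where landed; nothing here is a claim about the Yang–Mills mass gap

PDF held: `paper:balaban1984-cmp96-propagators-rt-ii` (journal page = PDF page + 222); pp. 224–228, 239–246 read on the text layer
(`lit read … --pages 17-28`, this seat, 2026-08-28) and through the verbatim quotations in the tree files cited below.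

CITATION HEADER (lean-in-tree rule).  Cell `pub-ymgap` (Track A of `YM-PLAN.md`, HUMAN RULING D-0062), node N10 [B13] lane owner `pub-ymgap-dag-n10-c`
(g17), ROAD «C» station C1 (bus INBOX 2026-08-28T15:23Z), filed `--supports stmt-QuantumFields-27364` (count-neutral helper).  WHY: the local-cube road of
the N10 lane (`B13DirichletLocalCoerciveBall` p638544 → `Summits/…/BalabanUVNodesN06Row17LocalClauseOnReg335OfL5Letters` p642828) displays the CENTRE
NUMBER `hco : m·⟨Ψ,Ψ⟩₁ ≤ ⟨Ψ, Δ_{a,□}(1)Ψ⟩₁` («m_□ volume-uniform = [4] Sect. B∕C, displayed»); at the letters those rows are typed at — def-Y's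
`Node00.OpsYDeltaA.deltaAY … 1`, which IS the lift of r03∕p21's V1 operator `B6SectAVectorModelV1.deltaAE` (`OpsYDeltaA.deltaAY_one_liftY`) — the tree has
only the qualitative `B6Eq231GaussianV1.exists_deltaAE_lower_bound` («γ depends on the finite lattice»).  THIS FILE is the algebraic heart of a
volume-uniform constant: it reduces the coercivity of `deltaAE D c w` (every nested family `D`, every lattice factor `c`, nonnegative weights) to three
LETTERS, each a printed statement of the paper that the tree proves in other carriers — Lemma 2.4 (2.128) (`Node00.Carriers3.lemma24_treeOfRecord`,
`B6Lemma24Torus.lemma24_torus`, `NodeOTorusLemma24.torus2128_of_Zd`), (2.11) (`B6Eq211.ineq211`), the axial gauge (2.121) (`B6BondElimination`,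
`B6AxialGaugeDictionary`) — with the constant EXPLICIT in the letters' constants.  Stations C2–C4 of the road bridge the letters to this model; C5
transfers to def-Y's letters and to the local `Δ_{a,□}`.  IMPORTS p21's `B6MinimalOrbitV1` (`QE_sub_dE`: `Q(A − ∂λ) = QA` on `N(Q′)`) and
`B6Eq28MultiLevelV1` (`dsE_sub_dE`, `RE_lapE_of_mem`: `R(Δλ) = Δλ` on `N(Q′)`), hence `B6SectAVectorModelV1` ∕ `B6SectACriticalPointV1`; nothing landed is
modified; nothing is restated (`inner_deltaAE_self`, `RE_comp_RE`, `inner_RE_left`, `dcE_comp_dE`, `inner_lapE_right` are used BY NAME).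

THE PRINT (verbatim).  p. 226: *«One of our main results will be that the operator Δ_a is bounded from below by a positive constant»*, with (2.19)
`Δ_a = ∂*∂ + ∂R∂* + Q*aQ`; p. 225, (2.10)–(2.12): *«let R be an orthogonal projection in the space L²(T_η) onto the subspace ΔN(Q′)»* and (2.11)
*«⟨λ, Δλ⟩ ≥ π² Σ_{j=1}^k (L^jη)^{−2} Σ_{x∈B^j(Λ_j)} η^d|λ(x)|², λ ∈ N(Q′)»*; p. 227: *«Because Q′λ′ = 0, hence QA^{λ′} = QA − ∂₁Q′λ′ = QA»*; p. 244,
(2.121): *«B(b) = 0 for b ⊂ Γ_{y,x}, x ∈ B(y), y ∈ Λ′»*; p. 245, Lemma 2.4 (2.128): *«L^{d−2} Σ_{c∈Λ′} |(Q₁B)(c)|² + Σ_p |(∂₁B)(p)|² ≥ (1∕(12d²))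
L^{−d−1} ‖B‖²»* for `B` in the gauge (2.121).

THE MECHANISM (ours; print proves the uniform bound through Sect. C).  Write `A = B + ∂λ` with `λ ∈ N(Q′)` and `B` axially gauged.  Then `∂A = ∂B`
(`curl_grad`), `QA = QB` (p. 227; r03's `constr_zero_grad`), and `R∂*A = R∂*B + Δλ` because `R` fixes `ΔN(Q′)` (`RE_fix`).  Hence
`⟨A, Δ_aA⟩ = ‖∂B‖² + ‖R∂*B + Δλ‖² + Σ w(QB)² ≥ κ‖B‖²` by the Lemma-2.4 letter, `‖Δλ‖ ≤ ⟨A,Δ_aA⟩^{1∕2} + ‖∂*B‖ ≤ ⟨A,Δ_aA⟩^{1∕2} + 2√d·|c|·‖B‖`,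
`‖∂λ‖² = ⟨λ, Δλ⟩ ≤ ‖λ‖‖Δλ‖ ≤ π^{−1∕2}‖∂λ‖‖Δλ‖` by the (2.11) letter, so `‖∂λ‖² ≤ π⁻¹‖Δλ‖²`, and `‖A‖² ≤ 2‖B‖² + 2‖∂λ‖²`.

WHAT IS PROVED (sorry-free; 0 `def`; standard axioms).
* §1 `coercive_of_gauge_letters_abstract` — the norm arithmetic above in ANY pair of normed groups (so that C5 can re-run it in def-Y's
  trace currency and for the local `Δ_{a,□}` with `R_□`): from `κ‖B‖² ≤ t`, `t + ‖r_A‖² ≤ F`, `r_A = r_B + ℓ`, `‖r_B‖ ≤ C_d^{1∕2}‖B‖`, `π‖g‖² ≤ ‖ℓ‖²·…`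
  (precisely: `‖g‖² ≤ π⁻¹‖ℓ‖²`) and `A = B + g` to `‖A‖² ≤ (2∕κ + (4∕π)(1 + C_d∕κ))·F`.
* §2 V1 letters: `normSq_eq_sum_sq` (`‖x‖² = Σ x_i²`), ★ `normSq_dsE_le` (`‖∂*A‖² ≤ 4d·c²·‖A‖²`), `norm_RE_le` (`‖Rf‖ ≤ ‖f‖`), `normSq_dE_eq_inner_lapE`
  (`‖∂λ‖² = ⟨λ, Δλ⟩`), ★ `normSq_dE_le_of_poincare` (`π‖λ‖² ≤ ‖∂λ‖² ⟹ ‖∂λ‖² ≤ π⁻¹‖Δλ‖²`).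
* §3 gauge bookkeeping for `λ ∈ N(Q′) = ker Q′` (over p21's `dcE_comp_dE`, `QE_sub_dE`, `dsE_sub_dE`, `RE_lapE_of_mem`): `dcE_sub_dE` (`∂(A − ∂λ) = ∂A`),
  `RE_dsE_sub_dE_of_mem_ker` (`R∂*(A − ∂λ) = R∂*A − Δλ`).
* §4 ★★★ `deltaAE_coercive_of_treeGauge_letters`: for every nested family `D`, `c`, weights `w ≥ 0`, every class `𝒯` of bond configurations with a
  Lemma-2.4-shaped letter `κ‖B‖² ≤ ‖∂B‖² + Σ_𝔅 w(QB)²` on `𝒯` (`κ > 0`), a (2.11)-shaped letter `π‖λ‖² ≤ ‖∂λ‖²` on `N(Q′)` (`π > 0`) and the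
  decomposition `∀ A ∃ λ ∈ N(Q′), A − ∂λ ∈ 𝒯`:  **`(2∕κ + (4∕π)·(1 + 4d·c²∕κ))⁻¹ · ‖A‖² ≤ ⟨A, Δ_aA⟩`** for every `A`; ★★ `deltaAE_coercive_of_treeGauge_letters'`
  (the same with the decomposition supplied for the one `A` only) and `exists_deltaAE_coercive_of_treeGauge_letters` (`∃ γ > 0` packaging, `γ` free of `A`
  and of the volume when `κ, π` are).
HONEST SCOPE.  Finite-dimensional algebra; the three letters are DISPLAYED (they are printed statements proved elsewhere in the tree, in other carriers —
see the citation header); NO inequality of the paper is asserted; the constant is ours.  NOT a node discharge; count-neutral; nothing continuum ∕ OS ∕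
mass gap ∕ Clay.
-/

open scoped InnerProductSpace

namespace Literature.MathematicalPhysics.QuantumFieldTheory.Balaban1983to89.B6SectADeltaACoerciveReductionV1

open LatticeFieldCalculus B6SectADomainsV1 B6SectAOperatorsV1 B6SectAVectorModelV1 B6SectACriticalPointV1
open BalabanImbrieJaffe1984to88.BIJ85AxialPropagator411 (BondSpace PlaqSpace)

noncomputable section

/-! ## §1. The norm arithmetic, abstractly (any normed groups) -/

section Abstract

variable {V S : Type*} [NormedAddCommGroup V] [NormedAddCommGroup S]

/-- ★ **THE REDUCTION ARITHMETIC.**  In normed groups `V ∋ A, B, g` and `S ∋ r_A, r_B, ℓ`: if `A = B + g`, `κ‖B‖² ≤ t`, `0 ≤ t`,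
`t + ‖r_A‖² ≤ F`, `r_A = r_B + ℓ`, `‖r_B‖² ≤ C_d‖B‖²`, and `‖g‖² ≤ π⁻¹‖ℓ‖²` (`κ, π > 0`, `C_d ≥ 0`), then
`‖A‖² ≤ (2∕κ + (4∕π)(1 + C_d∕κ))·F`.  (Here `t` = the curl and averaging squares, `r = R∂*`, `ℓ = Δλ`, `g = ∂λ`.)
[cite: Balaban1984PropagatorsII, (2.19) p.226, (2.10)–(2.12) p.225; folklore] -/
theorem coercive_of_gauge_letters_abstract {A B g : V} {rA rB ℓ : S} {κ π Cd t F : ℝ} (hκ : 0 < κ) (hπ : 0 < π) (hCd : 0 ≤ Cd)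
    (hA : A = B + g) (ht0 : 0 ≤ t) (hB : κ * ‖B‖ ^ 2 ≤ t) (hF : t + ‖rA‖ ^ 2 ≤ F) (hr : rA = rB + ℓ) (hrB : ‖rB‖ ^ 2 ≤ Cd * ‖B‖ ^ 2)
    (hg : ‖g‖ ^ 2 ≤ π⁻¹ * ‖ℓ‖ ^ 2) :
    ‖A‖ ^ 2 ≤ (2 / κ + 4 / π * (1 + Cd / κ)) * F := by
  have hF0 : 0 ≤ F := le_trans (add_nonneg ht0 (sq_nonneg _)) hF
  -- ‖B‖² ≤ F/κ
  have hB' : ‖B‖ ^ 2 ≤ F / κ := by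
    rw [le_div_iff₀ hκ]
    calc ‖B‖ ^ 2 * κ = κ * ‖B‖ ^ 2 := mul_comm _ _
      _ ≤ t := hB
      _ ≤ F := by nlinarith [sq_nonneg ‖rA‖]
  -- ‖ℓ‖ ≤ ‖rA‖ + ‖rB‖, hence ‖ℓ‖² ≤ 2‖rA‖² + 2‖rB‖² ≤ 2F + 2·C_d‖B‖²
  have hℓ : ‖ℓ‖ ≤ ‖rA‖ + ‖rB‖ := by
    have : ℓ = rA - rB := by rw [hr]; abel
    rw [this]; exact norm_sub_le _ _
  have hℓ2 : ‖ℓ‖ ^ 2 ≤ 2 * F + 2 * (Cd * ‖B‖ ^ 2) := by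
    have h1 : ‖ℓ‖ ^ 2 ≤ 2 * ‖rA‖ ^ 2 + 2 * ‖rB‖ ^ 2 := by
      nlinarith [hℓ, norm_nonneg ℓ, norm_nonneg rA, norm_nonneg rB, sq_nonneg (‖rA‖ - ‖rB‖)]
    have h2 : ‖rA‖ ^ 2 ≤ F := by nlinarith
    nlinarith
  -- ‖g‖² ≤ π⁻¹‖ℓ‖²
  have hg2 : ‖g‖ ^ 2 ≤ π⁻¹ * (2 * F + 2 * (Cd * (F / κ))) := by
    refine hg.trans (mul_le_mul_of_nonneg_left (hℓ2.trans ?_) (inv_nonneg.mpr hπ.le))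
    nlinarith [mul_le_mul_of_nonneg_left hB' hCd]
  -- ‖A‖² ≤ 2‖B‖² + 2‖g‖²
  have hA2 : ‖A‖ ^ 2 ≤ 2 * ‖B‖ ^ 2 + 2 * ‖g‖ ^ 2 := by
    rw [hA]
    nlinarith [norm_add_le B g, norm_nonneg (B + g), norm_nonneg B, norm_nonneg g, sq_nonneg (‖B‖ - ‖g‖)]
  calc ‖A‖ ^ 2 ≤ 2 * (F / κ) + 2 * (π⁻¹ * (2 * F + 2 * (Cd * (F / κ)))) := by nlinarith
    _ = (2 / κ + 4 / π * (1 + Cd / κ)) * F := by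
        field_simp
        ring

end Abstract

/-! ## §2. Letters of the V1 calculus: `‖∂*A‖² ≤ 4d·c²‖A‖²`, `‖Rf‖ ≤ ‖f‖`, `‖∂λ‖² ≤ π⁻¹‖Δλ‖²` under a Poincaré letter -/

variable {P : Params} (D : Domains P)

/-- the Euclidean norm of the model spaces as a sum of squares: `‖x‖² = Σ_i x_i²`. [cite: Balaban1984PropagatorsII, (2.8) p.224 (ℓ² pairing); folklore] -/
theorem normSq_eq_sum_sq {ι : Type*} [Fintype ι] (x : EuclideanSpace ℝ ι) : ‖x‖ ^ 2 = ∑ i, x i ^ 2 := by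
  rw [← real_inner_self_eq_norm_sq, inner_eq_sum]
  exact Finset.sum_congr rfl fun i _ => by ring

/-- a sum over the positively oriented bonds is a double sum over sites and directions. [cite: Balaban1985Averaging, (5) p.18 (bonds ⟨x, x+e_μ⟩); folklore] -/
theorem sum_bond_eq_sum_site_dir {α : Type*} [AddCommMonoid α] {j : ℕ} (F : PBond P j → α) :
    ∑ b : PBond P j, F b = ∑ x : Site P j, ∑ μ : Fin P.d, F ⟨x, μ⟩ :=
  calc ∑ b : PBond P j, F b = ∑ p : Site P j × Fin P.d, F (bondEquiv p) := (Equiv.sum_comp (bondEquiv (P := P) (j := j)) F).symm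
    _ = ∑ x : Site P j, ∑ μ : Fin P.d, F ⟨x, μ⟩ := Fintype.sum_prod_type _

/-- ★ **`‖∂*A‖² ≤ 4d·c²·‖A‖²`** — the divergence `(∂*A)(x) = Σ_μ c(A(x − e_μ, μ) − A(x, μ))` of (2.8)∕[B5] (1.21) collects `2d` bond values at each site,
each bond value entering at two sites (Cauchy–Schwarz and a reindexing by `x ↦ x − e_μ`). [cite: Balaban1984PropagatorsII, (2.8) p.224; Balaban1984PropagatorsI, (1.21) p.21] -/
theorem normSq_dsE_le (c : ℝ) (x : BondSpace P) : ‖dsE c x‖ ^ 2 ≤ 4 * P.d * c ^ 2 * ‖x‖ ^ 2 := by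
  classical
  rw [normSq_eq_sum_sq, normSq_eq_sum_sq]
  -- pointwise Cauchy–Schwarz at each site
  have h1 : ∀ s : Site P 0, dsE c x s ^ 2 ≤
      2 * P.d * c ^ 2 * (∑ μ : Fin P.d, x ⟨s.unshift μ, μ⟩ ^ 2 + ∑ μ : Fin P.d, x ⟨s, μ⟩ ^ 2) := fun s => by
    rw [dsE_apply]
    have hd : diverg c (WithLp.ofLp x) s = ∑ μ : Fin P.d, c * (x ⟨s.unshift μ, μ⟩ - x ⟨s, μ⟩) := by
      simp only [diverg, smul_eq_mul]
    rw [hd]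
    calc (∑ μ : Fin P.d, c * (x ⟨s.unshift μ, μ⟩ - x ⟨s, μ⟩)) ^ 2
        ≤ (Finset.univ : Finset (Fin P.d)).card * ∑ μ : Fin P.d, (c * (x ⟨s.unshift μ, μ⟩ - x ⟨s, μ⟩)) ^ 2 := sq_sum_le_card_mul_sum_sq
      _ ≤ (Finset.univ : Finset (Fin P.d)).card * ∑ μ : Fin P.d, c ^ 2 * (2 * (x ⟨s.unshift μ, μ⟩ ^ 2 + x ⟨s, μ⟩ ^ 2)) := by
          refine mul_le_mul_of_nonneg_left (Finset.sum_le_sum fun μ _ => ?_) (Nat.cast_nonneg _)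
          rw [mul_pow]
          refine mul_le_mul_of_nonneg_left ?_ (sq_nonneg c)
          nlinarith [sq_nonneg (x ⟨s.unshift μ, μ⟩ + x ⟨s, μ⟩)]
      _ = 2 * P.d * c ^ 2 * (∑ μ : Fin P.d, x ⟨s.unshift μ, μ⟩ ^ 2 + ∑ μ : Fin P.d, x ⟨s, μ⟩ ^ 2) := by
          rw [Finset.card_univ, Fintype.card_fin, ← Finset.sum_add_distrib, Finset.mul_sum, Finset.mul_sum]
          exact Finset.sum_congr rfl fun μ _ => by ring
  refine (Finset.sum_le_sum fun s _ => h1 s).trans ?_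
  rw [← Finset.mul_sum, Finset.sum_add_distrib]
  -- both double sums are `‖x‖²`
  have hsum1 : ∑ s : Site P 0, ∑ μ : Fin P.d, x ⟨s.unshift μ, μ⟩ ^ 2 = ∑ b : PBond P 0, x b ^ 2 := by
    rw [Finset.sum_comm]
    calc ∑ μ : Fin P.d, ∑ s : Site P 0, x ⟨s.unshift μ, μ⟩ ^ 2 = ∑ μ : Fin P.d, ∑ s : Site P 0, x ⟨s, μ⟩ ^ 2 :=
          Finset.sum_congr rfl fun μ _ =>
            Fintype.sum_equiv (shiftEquiv (P := P) (j := 0) μ).symm _ _ fun s => rfl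
      _ = ∑ b : PBond P 0, x b ^ 2 := by
          rw [Finset.sum_comm]; exact (sum_bond_eq_sum_site_dir (fun b : PBond P 0 => x b ^ 2)).symm
  have hsum2 : ∑ s : Site P 0, ∑ μ : Fin P.d, x ⟨s, μ⟩ ^ 2 = ∑ b : PBond P 0, x b ^ 2 :=
    (sum_bond_eq_sum_site_dir (fun b : PBond P 0 => x b ^ 2)).symm
  rw [hsum1, hsum2]
  nlinarith [Finset.sum_nonneg fun b (_ : b ∈ (Finset.univ : Finset (PBond P 0))) => sq_nonneg (x b), sq_nonneg c,
    Nat.cast_nonneg (α := ℝ) P.d]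

/-- `‖Rf‖ ≤ ‖f‖` — `R` is an orthogonal projection ((2.10)–(2.12): symmetric and idempotent, r03's `inner_RE_left`, `RE_comp_RE`).
[cite: Balaban1984PropagatorsII, (2.10)–(2.12) p.225] -/
theorem norm_RE_le (c : ℝ) (f : ScalarSpace P) : ‖RE D c f‖ ≤ ‖f‖ := by
  have hsq : ‖RE D c f‖ ^ 2 = ⟪f, RE D c f⟫_ℝ := by
    rw [← real_inner_self_eq_norm_sq, inner_RE_left]
    congr 1
    exact LinearMap.congr_fun (RE_comp_RE D c) f
  have h2 : ‖RE D c f‖ ^ 2 ≤ ‖f‖ * ‖RE D c f‖ := by rw [hsq]; exact real_inner_le_norm _ _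
  nlinarith [norm_nonneg (RE D c f), norm_nonneg f, sq_nonneg (‖RE D c f‖ - ‖f‖)]

/-- `‖R f‖² ≤ ‖f‖²`. [cite: Balaban1984PropagatorsII, (2.10)–(2.12) p.225] -/
theorem normSq_RE_le (c : ℝ) (f : ScalarSpace P) : ‖RE D c f‖ ^ 2 ≤ ‖f‖ ^ 2 :=
  pow_le_pow_left₀ (norm_nonneg _) (norm_RE_le D c f) 2

/-- `‖∂λ‖² = ⟨λ, Δλ⟩` (`Δ = ∂*∂`, `∂*` the adjoint of `∂`). [cite: Balaban1984PropagatorsII, (2.8) p.224; Balaban1984PropagatorsI, (1.21) p.21] -/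
theorem normSq_dE_eq_inner_lapE (c : ℝ) (n : ScalarSpace P) : ‖dE c n‖ ^ 2 = ⟪n, lapE c n⟫_ℝ := by
  rw [inner_lapE_right, real_inner_self_eq_norm_sq]

/-- ★ **from a Poincaré letter to the gradient–Laplacian bound**: `π‖λ‖² ≤ ‖∂λ‖²` with `π > 0` gives `‖∂λ‖² ≤ π⁻¹‖Δλ‖²`
(`‖∂λ‖² = ⟨λ, Δλ⟩ ≤ ‖λ‖‖Δλ‖ ≤ π^{−1∕2}‖∂λ‖‖Δλ‖`) — the shape in which (2.11) enters the reduction.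
[cite: Balaban1984PropagatorsII, (2.11) p.225] -/
theorem normSq_dE_le_of_poincare (c : ℝ) {π : ℝ} (hπ : 0 < π) {n : ScalarSpace P} (hP : π * ‖n‖ ^ 2 ≤ ‖dE c n‖ ^ 2) :
    ‖dE c n‖ ^ 2 ≤ π⁻¹ * ‖lapE c n‖ ^ 2 := by
  have h1 : ‖dE c n‖ ^ 2 ≤ ‖n‖ * ‖lapE c n‖ := by rw [normSq_dE_eq_inner_lapE]; exact real_inner_le_norm _ _
  -- square: ‖∂n‖⁴ ≤ ‖n‖²‖Δn‖² ≤ π⁻¹‖∂n‖²‖Δn‖²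
  have h2 : (‖dE c n‖ ^ 2) ^ 2 ≤ ‖n‖ ^ 2 * ‖lapE c n‖ ^ 2 := by
    rw [← mul_pow]; exact pow_le_pow_left₀ (sq_nonneg _) h1 2
  have h3 : ‖n‖ ^ 2 ≤ π⁻¹ * ‖dE c n‖ ^ 2 := by
    rw [← div_eq_inv_mul, le_div_iff₀ hπ, mul_comm]; exact hP
  have h4 : (‖dE c n‖ ^ 2) ^ 2 ≤ π⁻¹ * ‖dE c n‖ ^ 2 * ‖lapE c n‖ ^ 2 :=
    h2.trans (mul_le_mul_of_nonneg_right h3 (sq_nonneg _))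
  by_cases h0 : ‖dE c n‖ ^ 2 = 0
  · rw [h0]; positivity
  · have hpos : 0 < ‖dE c n‖ ^ 2 := lt_of_le_of_ne (sq_nonneg _) (Ne.symm h0)
    rw [pow_two (‖dE c n‖ ^ 2), mul_assoc] at h4
    exact le_of_mul_le_mul_left (by linarith [h4]) hpos

/-! ## §3. Gauge bookkeeping for `λ ∈ N(Q′) = ker Q′`: `∂(A − ∂λ) = ∂A`, `R∂*(A − ∂λ) = R∂*A − Δλ` -/

/-- `∂(A − ∂λ) = ∂A` (the gradient is curl-free: p21's `dcE_comp_dE`). [cite: Balaban1984PropagatorsI, (1.4) p.18; Balaban1984PropagatorsII, (2.5)–(2.7) p.224] -/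
theorem dcE_sub_dE (c : ℝ) (x : BondSpace P) (n : ScalarSpace P) : dcE c (x - dE c n) = dcE c x := by
  have h : dcE c (dE c n) = 0 := by simpa using LinearMap.congr_fun (dcE_comp_dE (P := P) c) n
  rw [map_sub, h, sub_zero]

/-- `R∂*(A − ∂λ) = R∂*A − Δλ` for `λ ∈ N(Q′)` — `∂*∂λ = Δλ` and `R` projects ONTO `ΔN(Q′)` (p21's `dsE_sub_dE`, `RE_lapE_of_mem`).
[cite: Balaban1984PropagatorsII, (2.8) p.224, (2.10)–(2.12) p.225] -/
theorem RE_dsE_sub_dE_of_mem_ker (c : ℝ) (x : BondSpace P) {n : ScalarSpace P} (hn : n ∈ LinearMap.ker (QpE D)) :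
    RE D c (dsE c (x - dE c n)) = RE D c (dsE c x) - lapE c n := by
  rw [B6Eq28MultiLevelV1.dsE_sub_dE, map_sub, B6Eq28MultiLevelV1.RE_lapE_of_mem D c hn]

/-! ## §4. ★★★ The coercivity of `Δ_a` from the three letters -/

/-- ★★ **COERCIVITY OF `Δ_a` FROM THE THREE LETTERS, for one configuration.**  Nested family `D`, lattice factor `c`, weights `w ≥ 0`; `A = B + ∂λ` with
`λ ∈ N(Q′)`, a Lemma-2.4-shaped bound `κ‖B‖² ≤ ‖∂B‖² + Σ_𝔅 w(QB)²` (`κ > 0`) for THIS `B`, and a (2.11)-shaped bound `π‖λ‖² ≤ ‖∂λ‖²` (`π > 0`) for THIS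
`λ` ⟹ `(2∕κ + (4∕π)(1 + 4d·c²∕κ))⁻¹·‖A‖² ≤ ⟨A, Δ_aA⟩`. [cite: Balaban1984PropagatorsII, (2.19) p.226, (2.11) p.225, Lemma 2.4 (2.128) p.245, (2.121) p.244] -/
theorem deltaAE_coercive_of_treeGauge_letters' (c : ℝ) {w : BondIdx D → ℝ} (hw : ∀ i, 0 ≤ w i) {κ π : ℝ} (hκ : 0 < κ) (hπ : 0 < π)
    (A : BondSpace P) {n : ScalarSpace P} (hn : n ∈ LinearMap.ker (QpE D))
    (hL24 : κ * ‖A - dE c n‖ ^ 2 ≤ ‖dcE c (A - dE c n)‖ ^ 2 + ∑ i, w i * QE D (A - dE c n) i ^ 2)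
    (hP : π * ‖n‖ ^ 2 ≤ ‖dE c n‖ ^ 2) :
    (2 / κ + 4 / π * (1 + 4 * P.d * c ^ 2 / κ))⁻¹ * ‖A‖ ^ 2 ≤ ⟪A, deltaAE D c w A⟫_ℝ := by
  set B : BondSpace P := A - dE c n with hBdef
  have hA : A = B + dE c n := by rw [hBdef, sub_add_cancel]
  -- the form as three squares, with `∂A = ∂B`, `QA = QB`
  have hform : ⟪A, deltaAE D c w A⟫_ℝ = ‖dcE c B‖ ^ 2 + ‖RE D c (dsE c A)‖ ^ 2 + ∑ i, w i * QE D B i ^ 2 := by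
    rw [inner_deltaAE_self, hBdef, dcE_sub_dE, B6MinimalOrbitV1.QE_sub_dE D c A hn]
  have ht0 : 0 ≤ ‖dcE c B‖ ^ 2 + ∑ i, w i * QE D B i ^ 2 :=
    add_nonneg (sq_nonneg _) (Finset.sum_nonneg fun i _ => mul_nonneg (hw i) (sq_nonneg _))
  have hF : (‖dcE c B‖ ^ 2 + ∑ i, w i * QE D B i ^ 2) + ‖RE D c (dsE c A)‖ ^ 2 ≤ ⟪A, deltaAE D c w A⟫_ℝ := by rw [hform]; linarith
  -- `R∂*A = R∂*B + Δλ`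
  have hr : RE D c (dsE c A) = RE D c (dsE c B) + lapE c n := by
    rw [hBdef, RE_dsE_sub_dE_of_mem_ker D c A hn, sub_add_cancel]
  have hrB : ‖RE D c (dsE c B)‖ ^ 2 ≤ 4 * P.d * c ^ 2 * ‖B‖ ^ 2 := (normSq_RE_le D c _).trans (normSq_dsE_le c B)
  have hg : ‖dE c n‖ ^ 2 ≤ π⁻¹ * ‖lapE c n‖ ^ 2 := normSq_dE_le_of_poincare c hπ hP
  have hCd : (0 : ℝ) ≤ 4 * P.d * c ^ 2 := by positivity
  have hmain := coercive_of_gauge_letters_abstract hκ hπ hCd hA ht0 hL24 hF hr hrB hg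
  have hpos : 0 < 2 / κ + 4 / π * (1 + 4 * P.d * c ^ 2 / κ) := by positivity
  rw [inv_mul_le_iff₀ hpos]
  exact hmain

/-- ★★★ **COERCIVITY OF `Δ_a` FROM THE THREE LETTERS** («the operator Δ_a is bounded from below by a positive constant», p. 226, with the constant
EXPLICIT in the letters' constants).  For every nested family `D`, lattice factor `c`, weights `w ≥ 0` on `𝔅`, and a class `𝒯` of bond configurations (the
axially gauged ones, (2.121)): a Lemma-2.4-shaped letter `κ‖B‖² ≤ ‖∂B‖² + Σ_𝔅 w(QB)²` on `𝒯` (`κ > 0`), a (2.11)-shaped letter `π‖λ‖² ≤ ‖∂λ‖²` on `N(Q′)`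
(`π > 0`), and the decomposition `∀ A ∃ λ ∈ N(Q′), A − ∂λ ∈ 𝒯` give **`(2∕κ + (4∕π)·(1 + 4d·c²∕κ))⁻¹ · ‖A‖² ≤ ⟨A, Δ_aA⟩` for every `A`** — a constant
depending on `κ, π, d, c` only. [cite: Balaban1984PropagatorsII, (2.19) p.226, (2.11) p.225, Lemma 2.4 (2.128) p.245, (2.121) p.244, p.227] -/
theorem deltaAE_coercive_of_treeGauge_letters (c : ℝ) {w : BondIdx D → ℝ} (hw : ∀ i, 0 ≤ w i) (𝒯 : Set (BondSpace P)) {κ π : ℝ} (hκ : 0 < κ)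
    (hπ : 0 < π) (hL24 : ∀ B ∈ 𝒯, κ * ‖B‖ ^ 2 ≤ ‖dcE c B‖ ^ 2 + ∑ i, w i * QE D B i ^ 2)
    (hP : ∀ n ∈ LinearMap.ker (QpE D), π * ‖n‖ ^ 2 ≤ ‖dE c n‖ ^ 2)
    (hdec : ∀ A : BondSpace P, ∃ n ∈ LinearMap.ker (QpE D), A - dE c n ∈ 𝒯) (A : BondSpace P) :
    (2 / κ + 4 / π * (1 + 4 * P.d * c ^ 2 / κ))⁻¹ * ‖A‖ ^ 2 ≤ ⟪A, deltaAE D c w A⟫_ℝ := by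
  obtain ⟨n, hn, hB⟩ := hdec A
  exact deltaAE_coercive_of_treeGauge_letters' D c hw hκ hπ A hn (hL24 _ hB) (hP n hn)

/-- `∃ γ > 0` packaging of the preceding theorem (the shape of r03's `B6Eq231GaussianV1.exists_deltaAE_lower_bound`, now with `γ` determined by the letters'
constants `κ, π` and `d, c` — hence volume-uniform whenever the letters are). [cite: Balaban1984PropagatorsII, (2.19) p.226] -/
theorem exists_deltaAE_coercive_of_treeGauge_letters (c : ℝ) {w : BondIdx D → ℝ} (hw : ∀ i, 0 ≤ w i) (𝒯 : Set (BondSpace P)) {κ π : ℝ}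
    (hκ : 0 < κ) (hπ : 0 < π) (hL24 : ∀ B ∈ 𝒯, κ * ‖B‖ ^ 2 ≤ ‖dcE c B‖ ^ 2 + ∑ i, w i * QE D B i ^ 2)
    (hP : ∀ n ∈ LinearMap.ker (QpE D), π * ‖n‖ ^ 2 ≤ ‖dE c n‖ ^ 2)
    (hdec : ∀ A : BondSpace P, ∃ n ∈ LinearMap.ker (QpE D), A - dE c n ∈ 𝒯) :
    ∃ γ : ℝ, 0 < γ ∧ γ = (2 / κ + 4 / π * (1 + 4 * P.d * c ^ 2 / κ))⁻¹ ∧ ∀ A : BondSpace P, γ * ‖A‖ ^ 2 ≤ ⟪A, deltaAE D c w A⟫_ℝ :=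
  ⟨_, by positivity, rfl, deltaAE_coercive_of_treeGauge_letters D c hw 𝒯 hκ hπ hL24 hP hdec⟩

end

end Literature.MathematicalPhysics.QuantumFieldTheory.Balaban1983to89.B6SectADeltaACoerciveReductionV1
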